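import Summits.QuantumFields.BalabanUV.T4Continuum.Spine.NE2.DeltaPrimeFieldStrength
import Summits.QuantumFields.BalabanUV.T4Continuum.Support.B13AvgCorrPlaquetteSecond
import Summits.QuantumFields.BalabanUV.T4Continuum.Support.HolonomyTowerRegularBridge

/-!
# T⁴ programme, spine node NE2 (U1a) — THE FIELD-STRENGTH BOUNDS (F0)/(F1) OF `Δ′` FROM THE (3.35)/(3.36) REGULARITY LETTERS OF THE BOND VARIABLES
# (cell `pub-balaban-gaps`, seat ne2 gen 3, file 2; lead ruling [LEAD-G6-RULINGS-1] (R-1): «suppliers of the Δ′ data hypotheses»)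

`Spine/NE2/DeltaPrimeFieldStrength.balaban326_rate_of_fieldStrength` reduced the `Δ′` hypotheses of the (3.26)-shape rate END to four bounds on the data `V`:
`‖V_k − 1‖ ≤ α₁/L^k`, (F0) `‖F_k‖ ≤ α₀`, (F1) `‖F_k(x − e_λ) − F_k(x)‖ ≤ α₀′/L^k`, (Fc) `‖F_{k+1}(y) − F_k(par y)‖ ≤ ρ/L^k` (`F_k = c_k²(U_k(∂p) − 1)`,
`c_k = L^k`).  THIS FILE supplies the first three from ONE hypothesis STRUCTURE on the bond variables themselves — `HolonomyTowerRegular.RegularSites L M V α₁ β₁ β₂`,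
the (3.35)+(3.36)-SHAPE letters of the tree (size `‖c_k(V_k − 1)‖ ≤ α₁` = «`|A| < O(1)Mα₀(Lʲη)⁻¹`», lattice-Lipschitz `c_k‖V_k(x + e_λ) − V_k(x)‖ ≤ β₁/c_k` =
«`|∇^η_U A| < O(1)Mα₀(Lʲη)⁻²`», second differences `c_k²‖V_k(x + e_λ + e_ρ) − V_k(x + e_λ) − V_k(x + e_ρ) + V_k(x)‖ ≤ β₂/c_k` = «`|∇^η_U∇^η_U A| < O(1)Mα₀(Lʲη)⁻³`»,
[B9] p. 396) — read HERE ON THE GAUGE FIELD `V` (so far the tree used `RegularSites` only on the adjoint transporters `Ad ∘ V`):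
(F0) with `α₀ = 2β₁ + 2α₁²` (**`norm_Fstr_le_of_reg`**) is row NE5's finest-plaquette letter `B13AvgCorrPlaquette.norm_plaquette_sub_one_le_of_reg` («two Lipschitz
letters and one commutator (size²)») BY NAME; (F1) with `α₀′ = (2β₂ + 4α₁β₁) + 2β₁(2β₁ + 2α₁²)` (**`Fstr_lipschitz_of_reg`**) is row NE5's second-order plaquette
letter `B13AvgCorrPlaquetteSecond.norm_plaquette_tau_sub_le_of_reg2` («the curl terms carry the second differences») BY NAME; `‖V_k − 1‖ ≤ α₁/c_k` is the size letter
(**`norm_V_sub_one_le_of_reg`**).  §1 is the dictionary between this seat's `plaqHol`/`Fstr` and row NE5's `R·R·R⋆·R⋆` (`⁻¹ = ⋆` on unitaries; the slot lift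
`liftR`), §2 the three suppliers, §3 the END **`balaban326_rate_of_bondRegular`**: print's (3.26)-shape rate END whose `Δ′` hypotheses are `RegularSites L M V α₁ β₁ β₂`
and the NE3-type consistency (Fc) of the field strength — NOTHING ELSE about `Δ′` (the connection binders `RegularSites (Ad ∘ V)` and node NE3's `LocalRate`
on `regClass₂ (Ad ∘ V)` BY NAME are unchanged).
HONEST FRAMING (T4-DAG p. 1).  Composition BY NAME at MODEL LEVEL (`V`, `e`, `c` DATA; hypothesis STRUCTURES displayed; (3.35)/(3.36) are SHAPE locators —
nothing printed is a hypothesis or a conclusion); NOT asserted: that `V` is Bałaban's minimiser, that the letters hold for it or that such a gauge exists (node NE3,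
OPEN; [Balaban1985RegularGauge] not formalised), the [B7] averaging (residual r2), m = k layer uniformity; NE2 (U1a) NOT PROVED; spine PROVED 0/9 unchanged;
NOT continuum YM / infinite volume / mass gap / Clay.  HONEST DEPENDENCY: continuum YM on T⁴ ⇐ BetaPertH ∧ nine spine estimates (0/9 proved); BetaPertH ⇐
(D1) ∧ (D4) ∧ CAP+tail; G-an2-4 gates asym, D1 and NE2/3/4.  No `sorry`, no `def`.
-/

noncomputable section

open scoped BigOperators ComplexConjugate Matrix

namespace Summit.QuantumFields.BalabanUV.T4Continuum.NE2.DeltaPrimeBondData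

open scoped Kronecker Matrix.Norms.L2Operator
open Literature.MathematicalPhysics.QuantumFieldTheory.Balaban1983to89.B5Prop11Plancherel (Tor fine unitVec Cst)
open Literature.MathematicalPhysics.QuantumFieldTheory.Balaban1983to89.B5G183RateUnitTower (lev lev_neZero)
open Literature.MathematicalPhysics.QuantumFieldTheory.Balaban1983to89.T4EtaRateMin (LocalRate)
open Summit.QuantumFields.BalabanUV.T4Continuum
open Summit.QuantumFields.BalabanUV.T4Continuum.BalabanAveragedTowerUnit (idx Qlev one_le_lev' lev_succ')
open Summit.QuantumFields.BalabanUV.T4Continuum.BalabanAveragedTowerModes (par)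
open Summit.QuantumFields.BalabanUV.T4Continuum.BlockPairingGeometry (tau)
open Summit.QuantumFields.BalabanUV.T4Continuum.CovariantAveragingTower (TowerLimitRate)
open Summit.QuantumFields.BalabanUV.T4Continuum.CovariantBlockAveraging (QcovLev)
open Summit.QuantumFields.BalabanUV.T4Continuum.BackgroundResolventTower (Cpert)
open Summit.QuantumFields.BalabanUV.T4Continuum.KingPairingPlantedLaw (CJ)
open Summit.QuantumFields.BalabanUV.T4Continuum.NE2FromNE3 (bgReadings)
open Summit.QuantumFields.BalabanUV.T4Continuum.RegularBackgroundTower (RegularTransporters betaNE3 lev_pos)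
open Summit.QuantumFields.BalabanUV.T4Continuum.HolonomyTowerRegular (RegularSites regClass₂ wT DqT)
open Summit.QuantumFields.BalabanUV.T4Continuum.B13AvgCorrPlaquette (norm_plaquette_sub_one_le_of_reg norm_sub_one_le_of_reg)
open Summit.QuantumFields.BalabanUV.T4Continuum.B13AvgCorrPlaquetteSecond (norm_plaquette_tau_sub_le_of_reg2)
open Summit.QuantumFields.BalabanUV.T4Continuum.GaugeTermScalarData (QuT)
open Summit.QuantumFields.BalabanUV.T4Continuum.RegularSiteTransporters (siteT)
open Summit.QuantumFields.BalabanUV.T4Continuum.NestedContourTransport (theta0)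
open Summit.QuantumFields.BalabanUV.T4Continuum.GramPerturbationLaw (C2gram)
open Summit.QuantumFields.BalabanUV.T4Continuum.NE2BalabanGauge (liftR)
open Summit.QuantumFields.BalabanUV.T4Continuum.NE2BalabanLayerSharp (kappaBs C2Bs)
open Summit.QuantumFields.BalabanUV.T4Continuum.NE2BalabanWiring (epsR CdeltaR)
open Summit.QuantumFields.BalabanUV.T4Continuum.NE2BalabanFinal (kappa4F C4F)
open Summit.QuantumFields.BalabanUV.T4Continuum.NE2BalabanThreshold (etaStar)
open Summit.QuantumFields.BalabanUV.T4Continuum.GaugeTermSandwichBound (projP)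
open Summit.QuantumFields.BalabanUV.T4Continuum.GaugeTermLayer (Gop)
open Summit.QuantumFields.BalabanUV.Beta.AdjointCarrierWiringEnd (CompFamily)
open Summit.QuantumFields.BalabanUV.T4Continuum.NE2.AdjointFieldInstance (adRep)
open Summit.QuantumFields.BalabanUV.T4Continuum.NE2.DeltaPrimeOperator
open Summit.QuantumFields.BalabanUV.T4Continuum.NE2.DictionaryB0 (principalB9)
open Summit.QuantumFields.BalabanUV.T4Continuum.NE2.DeltaPrimeSecondOrder
open Summit.QuantumFields.BalabanUV.T4Continuum.NE2.DeltaPrimeFieldStrength (Fstr symL brkL balaban326_rate_of_fieldStrength)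

variable {n : Type} [Fintype n] [DecidableEq n] {d : ℕ} {ι : Type} [Fintype ι] [DecidableEq ι]

/-! ## §1 Dictionary: this seat's plaquette holonomy / field strength vs row NE5's `R·R·R⋆·R⋆` on the slot lift -/

section Dictionary

variable (L : ℕ) [NeZero L] (M : Fin d → ℕ) [hM : ∀ μ, NeZero (M μ)]
variable (V : (k : ℕ) → Fin d → Tor (fine (lev L k) M) → Matrix.unitaryGroup n ℂ)

omit hM in
/-- the second-difference letter of `RegularSites` (`lipschitz₂`, on `DqT = c_k²·(first difference)`), in row NE5's phrasing
`‖c_k·(V(i + e_ν + e_ρ) − V(i + e_ν) − V(i + e_ρ) + V(i))‖ ≤ β₂/c_k²` on the slot lift. [folklore] -/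
theorem second_diff_letter_of_reg {α₁ β₁ β₂ : ℝ} (h : RegularSites L M (fun k ν x => (V k ν x : Matrix n n ℂ)) α₁ β₁ β₂)
    (k : ℕ) (μ ν ρ : Fin d) (i : idx L M k) :
    ‖((lev L k : ℕ) : ℂ) • ((fun k => GaugeTermDecomposition.liftR (fine (lev L k) M) (fun ν x => (V k ν x : Matrix n n ℂ))) k μ
          (tau (fine (lev L k) M) ν (tau (fine (lev L k) M) ρ i))
        - (fun k => GaugeTermDecomposition.liftR (fine (lev L k) M) (fun ν x => (V k ν x : Matrix n n ℂ))) k μ (tau (fine (lev L k) M) ν i)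
        - (fun k => GaugeTermDecomposition.liftR (fine (lev L k) M) (fun ν x => (V k ν x : Matrix n n ℂ))) k μ (tau (fine (lev L k) M) ρ i)
        + (fun k => GaugeTermDecomposition.liftR (fine (lev L k) M) (fun ν x => (V k ν x : Matrix n n ℂ))) k μ i)‖
      ≤ β₂ / ((lev L k : ℕ) : ℝ) ^ 2 := by
  have hℓ : (0 : ℝ) < (lev L k : ℕ) := lev_pos L k
  set X : Matrix n n ℂ := (V k μ (tau (fine (lev L k) M) ν (tau (fine (lev L k) M) ρ i)).1 : Matrix n n ℂ)
      - (V k μ (tau (fine (lev L k) M) ν i).1 : Matrix n n ℂ) - (V k μ (tau (fine (lev L k) M) ρ i).1 : Matrix n n ℂ) + (V k μ i.1 : Matrix n n ℂ) with hXdef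
  have h1 := h.lipschitz₂ k ν μ ρ i
  have hX : DqT L M (fun k ν x => (V k ν x : Matrix n n ℂ)) ν k μ (tau (fine (lev L k) M) ρ i) - DqT L M (fun k ν x => (V k ν x : Matrix n n ℂ)) ν k μ i
      = (((lev L k : ℕ) : ℂ) * ((lev L k : ℕ) : ℂ)) • X := by
    simp only [DqT, wT, hXdef]
    module
  rw [hX, norm_smul, norm_mul, Complex.norm_natCast, le_div_iff₀ hℓ] at h1
  have hgoal : ((fun k => GaugeTermDecomposition.liftR (fine (lev L k) M) (fun ν x => (V k ν x : Matrix n n ℂ))) k μ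
          (tau (fine (lev L k) M) ν (tau (fine (lev L k) M) ρ i))
        - (fun k => GaugeTermDecomposition.liftR (fine (lev L k) M) (fun ν x => (V k ν x : Matrix n n ℂ))) k μ (tau (fine (lev L k) M) ν i)
        - (fun k => GaugeTermDecomposition.liftR (fine (lev L k) M) (fun ν x => (V k ν x : Matrix n n ℂ))) k μ (tau (fine (lev L k) M) ρ i)
        + (fun k => GaugeTermDecomposition.liftR (fine (lev L k) M) (fun ν x => (V k ν x : Matrix n n ℂ))) k μ i) = X := by
    simp only [GaugeTermDecomposition.liftR, hXdef]
  rw [hgoal, norm_smul, Complex.norm_natCast, le_div_iff₀ (by positivity)]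
  calc ((lev L k : ℕ) : ℝ) * ‖X‖ * ((lev L k : ℕ) : ℝ) ^ 2 = ((lev L k : ℕ) : ℝ) * ((lev L k : ℕ) : ℝ) * ‖X‖ * ((lev L k : ℕ) : ℝ) := by ring
    _ ≤ β₂ := h1

omit [NeZero L] hM in
/-- **DICTIONARY**: this seat's plaquette holonomy (backward bonds INVERTED, (3.5)) IS row NE5's `R_μ(i)·R_ν(i + e_μ)·R_μ(i + e_ν)⋆·R_ν(i)⋆` on the slot lift
(`⁻¹ = ⋆` for unitary bond variables). [folklore] -/
theorem plaqHol_eq_starForm (k : ℕ) (μ ν : Fin d) (i : idx L M k) :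
    plaqHol (fine (lev L k) M) (fun ν x => (V k ν x : Matrix n n ℂ)) i.1 μ ν
      = (fun k => GaugeTermDecomposition.liftR (fine (lev L k) M) (fun ν x => (V k ν x : Matrix n n ℂ))) k μ i
        * (fun k => GaugeTermDecomposition.liftR (fine (lev L k) M) (fun ν x => (V k ν x : Matrix n n ℂ))) k ν (tau (fine (lev L k) M) μ i)
        * star ((fun k => GaugeTermDecomposition.liftR (fine (lev L k) M) (fun ν x => (V k ν x : Matrix n n ℂ))) k μ (tau (fine (lev L k) M) ν i))
        * star ((fun k => GaugeTermDecomposition.liftR (fine (lev L k) M) (fun ν x => (V k ν x : Matrix n n ℂ))) k ν i) := by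
  simp only [plaqHol, GaugeTermDecomposition.liftR, BlockPairingGeometry.tau]
  rw [Matrix.inv_eq_left_inv (Matrix.mem_unitaryGroup_iff'.mp (V k μ (i.1 + unitVec _ ν)).2),
    Matrix.inv_eq_left_inv (Matrix.mem_unitaryGroup_iff'.mp (V k ν i.1).2)]

omit [NeZero L] hM in
/-- `‖F_k(p)‖ = c_k²·‖U_k(∂p) − 1‖`. [folklore] -/
theorem norm_Fstr_eq (k : ℕ) (μ ν : Fin d) (x : Tor (fine (lev L k) M)) :
    ‖Fstr (fine (lev L k) M) (lev L k) (fun ν x => (V k ν x : Matrix n n ℂ)) μ ν x‖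
      = ((lev L k : ℕ) : ℝ) ^ 2 * ‖plaqHol (fine (lev L k) M) (fun ν x => (V k ν x : Matrix n n ℂ)) x μ ν - 1‖ := by
  rw [Fstr, norm_smul, norm_pow, Complex.ofReal_natCast, Complex.norm_natCast]

omit [NeZero L] hM in
/-- `F_k(x − e_λ) − F_k(x) = −c_k²·(U_k(∂p_x) − U_k(∂p_{x − e_λ}))`. [folklore] -/
theorem Fstr_sub_eq (k : ℕ) (μ ν lam : Fin d) (x : Tor (fine (lev L k) M)) :
    Fstr (fine (lev L k) M) (lev L k) (fun ν x => (V k ν x : Matrix n n ℂ)) μ ν (x - unitVec _ lam)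
        - Fstr (fine (lev L k) M) (lev L k) (fun ν x => (V k ν x : Matrix n n ℂ)) μ ν x
      = -(((((lev L k : ℕ) : ℝ) : ℂ) ^ 2) • (plaqHol (fine (lev L k) M) (fun ν x => (V k ν x : Matrix n n ℂ)) x μ ν
          - plaqHol (fine (lev L k) M) (fun ν x => (V k ν x : Matrix n n ℂ)) (x - unitVec _ lam) μ ν)) := by
  rw [Fstr, Fstr, ← smul_sub, ← smul_neg, neg_sub, sub_sub_sub_cancel_right]

end Dictionary

/-! ## §2 The three suppliers: size of `V − 1`, (F0), (F1) from `RegularSites L M V α₁ β₁ β₂` -/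

section Suppliers

variable (L : ℕ) [NeZero L] (M : Fin d → ℕ) [hM : ∀ μ, NeZero (M μ)]
variable (V : (k : ℕ) → Fin d → Tor (fine (lev L k) M) → Matrix.unitaryGroup n ℂ) {α₁ β₁ β₂ : ℝ}

omit hM in
/-- **SIZE LETTER**: `‖V_k − 1‖ ≤ α₁/c_k`. [folklore] -/
theorem norm_V_sub_one_le_of_reg (h : RegularSites L M (fun k ν x => (V k ν x : Matrix n n ℂ)) α₁ β₁ β₂) (k : ℕ) (μ : Fin d)
    (x : Tor (fine (lev L k) M)) : ‖(V k μ x : Matrix n n ℂ) - 1‖ ≤ α₁ / (lev L k : ℕ) :=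
  norm_sub_one_le_of_reg L M h.toRegularTransporters k μ (x, μ)

omit hM in
/-- **(F0) FROM THE (3.35)-SHAPE LETTERS**: `‖F_k‖ ≤ 2β₁ + 2α₁²` (two Lipschitz letters and one commutator = size²; row NE5's κ-L2 BY NAME). [folklore] -/
theorem norm_Fstr_le_of_reg (h : RegularSites L M (fun k ν x => (V k ν x : Matrix n n ℂ)) α₁ β₁ β₂) (k : ℕ) (μ ν : Fin d)
    (x : Tor (fine (lev L k) M)) :
    ‖Fstr (fine (lev L k) M) (lev L k) (fun ν x => (V k ν x : Matrix n n ℂ)) μ ν x‖ ≤ 2 * β₁ + 2 * α₁ ^ 2 := by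
  have hℓ : (0 : ℝ) < (lev L k : ℕ) := lev_pos L k
  have hmain := norm_plaquette_sub_one_le_of_reg L M h.toRegularTransporters (fun k μ i => (V k μ i.1).2) k μ ν (x, μ)
  rw [← plaqHol_eq_starForm L M V k μ ν (x, μ)] at hmain
  rw [norm_Fstr_eq, ← le_div_iff₀' (pow_pos hℓ 2)]
  exact hmain

omit hM in
/-- **(F1) FROM THE (3.35)+(3.36)-SHAPE LETTERS**: `‖F_k(x − e_λ) − F_k(x)‖ ≤ ((2β₂ + 4α₁β₁) + 2β₁(2β₁ + 2α₁²))/c_k` (row NE5's σ-L2 BY NAME, at the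
backward-shifted corner; `c_k⁻² ≤ c_k⁻¹`). [folklore] -/
theorem Fstr_lipschitz_of_reg (h : RegularSites L M (fun k ν x => (V k ν x : Matrix n n ℂ)) α₁ β₁ β₂) (k : ℕ) (μ ν lam : Fin d)
    (x : Tor (fine (lev L k) M)) :
    ‖Fstr (fine (lev L k) M) (lev L k) (fun ν x => (V k ν x : Matrix n n ℂ)) μ ν (x - unitVec _ lam)
        - Fstr (fine (lev L k) M) (lev L k) (fun ν x => (V k ν x : Matrix n n ℂ)) μ ν x‖
      ≤ ((2 * β₂ + 4 * α₁ * β₁) + 2 * β₁ * (2 * β₁ + 2 * α₁ ^ 2)) / (lev L k : ℕ) := by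
  have hℓ1 : (1 : ℝ) ≤ (lev L k : ℕ) := by exact_mod_cast one_le_lev' L k
  have hℓ : (0 : ℝ) < (lev L k : ℕ) := by linarith
  have hα := h.nonneg.1
  have hβ := h.nonneg.2.1
  set i : idx L M k := (x - unitVec _ lam, μ) with hi
  have hτ : tau (fine (lev L k) M) lam i = (x, μ) := by
    simp only [hi, BlockPairingGeometry.tau, sub_add_cancel]
  have hmain := norm_plaquette_tau_sub_le_of_reg2 L M h.toRegularTransporters (fun k μ i => (V k μ i.1).2) (second_diff_letter_of_reg L M V h)
    k μ ν lam i
  rw [← plaqHol_eq_starForm L M V k μ ν (tau (fine (lev L k) M) lam i), ← plaqHol_eq_starForm L M V k μ ν i, hτ] at hmain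
  rw [Fstr_sub_eq, norm_neg, norm_smul, norm_pow, Complex.ofReal_natCast, Complex.norm_natCast]
  calc ((lev L k : ℕ) : ℝ) ^ 2 * ‖plaqHol (fine (lev L k) M) (fun ν x => (V k ν x : Matrix n n ℂ)) x μ ν
          - plaqHol (fine (lev L k) M) (fun ν x => (V k ν x : Matrix n n ℂ)) (x - unitVec _ lam) μ ν‖
      ≤ ((lev L k : ℕ) : ℝ) ^ 2 * ((2 * β₂ + 4 * α₁ * β₁) / ((lev L k : ℕ) : ℝ) ^ 3 + 2 * β₁ * (2 * β₁ + 2 * α₁ ^ 2) / ((lev L k : ℕ) : ℝ) ^ 4) :=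
        mul_le_mul_of_nonneg_left hmain (by positivity)
    _ = (2 * β₂ + 4 * α₁ * β₁) / (lev L k : ℕ) + 2 * β₁ * (2 * β₁ + 2 * α₁ ^ 2) / ((lev L k : ℕ) : ℝ) ^ 2 := by
        field_simp
    _ ≤ (2 * β₂ + 4 * α₁ * β₁) / (lev L k : ℕ) + 2 * β₁ * (2 * β₁ + 2 * α₁ ^ 2) / (lev L k : ℕ) := by
        have h4 : 2 * β₁ * (2 * β₁ + 2 * α₁ ^ 2) / ((lev L k : ℕ) : ℝ) ^ 2 ≤ 2 * β₁ * (2 * β₁ + 2 * α₁ ^ 2) / (lev L k : ℕ) :=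
          div_le_div_of_nonneg_left (by positivity) hℓ (by nlinarith)
        linarith
    _ = ((2 * β₂ + 4 * α₁ * β₁) + 2 * β₁ * (2 * β₁ + 2 * α₁ ^ 2)) / (lev L k : ℕ) := by ring

end Suppliers

/-! ## §3 The rate END with the `Δ′` hypotheses = `RegularSites L M V α₁ β₁ β₂` + the NE3-type consistency of the field strength -/

section Rate

variable (L : ℕ) [NeZero L] (M : Fin d → ℕ) [hM : ∀ μ, NeZero (M μ)] (a : ℝ) (ha : 0 < a) {c : ℝ} {e : ι → Matrix n n ℂ}

include ha in
/-- **RATE END FOR PRINT'S (3.26) SHAPE, `Δ′` HYPOTHESES = THE (3.35)/(3.36) LETTERS OF THE GAUGE FIELD + NE3-CONSISTENCY OF ITS FIELD STRENGTH.**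
`DeltaPrimeFieldStrength.balaban326_rate_of_fieldStrength` with `hV1`, (F0), (F1) DISCHARGED by §2 (`α₁`, `α₀ = 2β₁ + 2α₁²`, `α₀′ = (2β₂ + 4α₁β₁) + 2β₁(2β₁ + 2α₁²)`):
the hypotheses about (3.10)'s `Δ′` are now `hregV : RegularSites L M V α₁ β₁ β₂` (size / lattice-Lipschitz / second-difference letters of the BOND VARIABLES, the
(3.35)+(3.36) shapes) and `hFc` (block-parent consistency of `F_k = c_k²(U_k(∂p) − 1)`, node NE3's currency); the connection binders (`RegularSites (Ad ∘ V) α β β₂′`,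
node NE3's `LocalRate` on `regClass₂ (Ad ∘ V)` BY NAME), `α, β ≤ η ≤ etaStar` and ONE threshold are as before.  Model level: `V` is DATA; that Bałaban's minimiser
is this regular in his gauge is [B9] (3.35)–(3.36) + node NE3 (OPEN); averaging = the model's (residual r2); NE2 (U1a) NOT proved by this.
[cite: Balaban1985BackgroundPropagators, (3.10) p.392, (3.26) p.395, (3.35)–(3.36) p.396 (shapes)] [folklore] -/
theorem balaban326_rate_of_bondRegular [Nonempty n] [Nonempty ι] {Pc : Submodule ℝ (Matrix n n ℂ)} (hF : CompFamily c Pc e) (hL : 2 ≤ L) (hd : 1 ≤ d)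
    (V : (k : ℕ) → Fin d → Tor (fine (lev L k) M) → Matrix.unitaryGroup n ℂ)
    {α₁ β₁ β₂ : ℝ} (hregV : RegularSites L M (fun k ν x => (V k ν x : Matrix n n ℂ)) α₁ β₁ β₂)
    {α β β₂' : ℝ} (hreg₂ : RegularSites L M (fun k ν x => adRep hF (V k ν x)) α β β₂') {C : ℝ} (hC : 0 ≤ C)
    (hNE3₂ : LocalRate (bgReadings L M (regClass₂ L M (fun k ν x => adRep hF (V k ν x)))) C ((L : ℝ)⁻¹)) {a' : ℝ} (ha' : 0 < a')
    {η : ℝ} (hαη : α ≤ η) (hβη : β ≤ η) (hη : η ≤ etaStar ι d a a') {ρ : ℝ} (hρ : 0 ≤ ρ)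
    (hFc : ∀ k μ ν (y : Tor (fine (lev L (k + 1)) M)), ‖Fstr (fine (lev L (k + 1)) M) (lev L (k + 1)) (fun ν x => (V (k + 1) ν x : Matrix n n ℂ)) μ ν y
      - Fstr (fine (lev L k) M) (lev L k) (fun ν x => (V k ν x : Matrix n n ℂ)) μ ν (par (lev L k) L M y)‖ ≤ ρ / (lev L k : ℕ))
    (hthr : (kappaBs ι d a α β (a * (epsR ι d α * (2 + epsR ι d α) * Cst d a)) (kappa4F d a a' α β)
      + (d : ℝ) ^ 2 * ((2 * β + 2 * α ^ 2) * Cst d a)) + kappaDP d a (‖symL c e‖ * (2 * β₁ + 2 * α₁ ^ 2) ^ 2 / 2) (‖brkL c e‖ * (2 * β₁ + 2 * α₁ ^ 2)) < 1) :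
    TowerLimitRate (fun k => Qlev L M k ⊗ₖ (1 : Matrix ι ι ℂ)) ((L : ℝ) ^ d)
      (fun k => (principalB9 (fine (lev L k) M) ((lev L k : ℕ) : ℂ) (fun ν x => adRep hF (V k ν x))
          (projP (fine (lev L k) M) (Gop L M (fun k ν x => adRep hF (V k ν x)) (QuT L M ι (siteT L M (fun k ν x => adRep hF (V k ν x)))) a' k)
            (QuT L M ι (siteT L M (fun k ν x => adRep hF (V k ν x))) k))
        + (a : ℂ) • (((((lev L k : ℕ) : ℂ) ^ d) • (QcovLev L M (liftR L M (fun k ν x => adRep hF (V k ν x))) k)ᴴ)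
            * QcovLev L M (liftR L M (fun k ν x => adRep hF (V k ν x))) k)
        + deltaPrime (fine (lev L k) M) (lev L k) c e (fun ν x => (V k ν x : Matrix n n ℂ)))⁻¹)
      (Cpert ((kappaBs ι d a α β (a * (epsR ι d α * (2 + epsR ι d α) * Cst d a)) (kappa4F d a a' α β)
          + (d : ℝ) ^ 2 * ((2 * β + 2 * α ^ 2) * Cst d a))
          + kappaDP d a (‖symL c e‖ * (2 * β₁ + 2 * α₁ ^ 2) ^ 2 / 2) (‖brkL c e‖ * (2 * β₁ + 2 * α₁ ^ 2))) (2 * d * Cst d a) (CJ d a)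
        ((C2Bs ι d L a α β (betaNE3 ι C + β₂')
            (a * C2gram (Cst d a) 1 (epsR ι d α) (2 * d * Cst d a) (CJ d a) (Cst d a)
              (CdeltaR ι d a α (theta0 d α (betaNE3 ι (betaNE3 ι C + β₂')))))
            (C4F ι d L a a' α β (betaNE3 ι C + β₂'))
          + (d : ℝ) ^ 2 * (Cst d a * ((2 * β + 2 * α ^ 2) * (2 * Cst d a) + (2 * (betaNE3 ι C + β₂') + 4 * α * (betaNE3 ι C + β)) * Cst d a)))
          + CDP d a (‖symL c e‖ * (2 * β₁ + 2 * α₁ ^ 2) ^ 2 / 2)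
              (‖symL c e‖ * (2 * β₁ + 2 * α₁ ^ 2) ^ 2 / 2 * (4 * α₁)
                + (‖symL c e‖ * (2 * β₁ + 2 * α₁ ^ 2) ^ 2 + ‖symL c e‖ * (2 * β₁ + 2 * α₁ ^ 2) ^ 2)
                + ‖symL c e‖ * (2 * β₁ + 2 * α₁ ^ 2) ^ 2 / 2 * (4 * α₁))
              (‖brkL c e‖ * (2 * β₁ + 2 * α₁ ^ 2))
              (‖brkL c e‖ * (2 * β₁ + 2 * α₁ ^ 2) * (4 * α₁)
                + (‖brkL c e‖ * ρ + ‖brkL c e‖ * ((2 * β₂ + 4 * α₁ * β₁) + 2 * β₁ * (2 * β₁ + 2 * α₁ ^ 2)))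
                + ‖brkL c e‖ * (2 * β₁ + 2 * α₁ ^ 2) * (4 * α₁)))
        0 1) ((L : ℝ)⁻¹) :=
  have hα₁ := hregV.nonneg.1
  have hβ₁ := hregV.nonneg.2.1
  have hβ₂ := hregV.nonneg.2.2
  balaban326_rate_of_fieldStrength L M a ha hF hL hd V hreg₂ hC hNE3₂ ha' hαη hβη hη hα₁ (by positivity) (by positivity) hρ
    (norm_V_sub_one_le_of_reg L M V hregV) (norm_Fstr_le_of_reg L M V hregV) (Fstr_lipschitz_of_reg L M V hregV) hFc hthr

end Rate

end Summit.QuantumFields.BalabanUV.T4Continuum.NE2.DeltaPrimeBondData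

end
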